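import Summits.RiemannHypothesis.RiemannHypothesis.Theorems.EarlyAppointmentsRemainder0XiAbelHighSide

/-!
# ⟨24730⟩ ρ2 v4 — LEAF 1 (`KernelShiftLeaf`), UPPER SIDE of the shift-kernel height sum (BPT Theorem 2, T-uniform) PROVED

C4 «kernel desk» rh-idea-6 g30, director (CA406)(d).  SUPPORT module for crux r3 `Remainder0Xi` (line rho2_v4), fully proved,
standard axioms; imports = pre-image `…AbelHighSide` (C4 g30, 6fe78249: `abs_Q_le_tangent`, and through it the tree's
`Literature…ZetaZeroSumsLehmanLimits` = `BrentPlattTrudgian2021_thm2`, `BPT2021.abs_integral_Ioi_count_sub_countMain_mul_deriv_le`,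
`…HeightSumAbelBound.abs_Q_le_hsw`).
The twin of …AbelHighSide with `φ_up ↦ ψ_up`, `ψ_up(t) = 2/(t − x)²` (`psiUp x t`; positive, decreasing on `t > x`):
* `psiUp_hyps (hxT : x < T₀)`: `C¹`, `≥ 0`, `ψ_up' = −4/(t−x)³ ≤ 0` on `Ici T₀`;
* `integral_psiUp_eq`: `∫_{Ioi T₀} ψ_up = 2/(T₀ − x)` (antiderivative `−2/(t − x) → 0`), `integrableOn_psiUp_div`,
  `integral_psiUp_div_le : ∫_{Ioi T₀} ψ_up/t ≤ 2/((T₀ − x)·T₀)` (domination `ψ/t ≤ ψ/T₀`);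
* ★ `highSide_tendsto_sq (hxT : x < T₀) (h3 : 3 ≤ T₀)` = BPT Thm 2 for `ψ_up`:
  `Σ_{T₀<γ≤T} ord·ψ_up(γ) − (∫_{T₀}^T ψ_up·log(t/2π))/(2π) → Fsq x T₀` (`T`-UNIFORM, no `log T` growth);
* ★ `abs_Fsq_le … (he : e ≤ T₀) : |Fsq x T₀| ≤ 2·W_N(T₀)·ψ_up(T₀) + (0.1038 + 0.2573/log T₀)·∫_{Ioi T₀} ψ_up/t`;
* ★ `integral_psiUp_log_le (hT : T₀ ≤ T) (h2π : 2π ≤ T₀)`: the main term `(∫_{T₀}^T ψ_up·log(t/2π))/(2π) ≤ log(T/2π)·(2/(T₀ − x))/(2π)`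
  — NOTE this carries `log T`, not `log x`: for the ε-eventual form of LEAF 1 the successor splits `∫_{T₀}^T = ∫_{T₀}^{2x} + ∫_{2x}^T`
  with `log(t/2π) ≤ log(2x/2π)` on the first and `ψ_up ≤ 8/t²`-type decay on the second (recipe in HANDOFF §g30), or prices
  the main term against MAIN's own upper integral; the error terms above are already `T`-free.
With `T₀ = x + 67.5`: `2ψ_up(T₀) = 4/67.5² ≈ 8.78·10⁻⁴`, `∫ψ_up/t ≤ 2/(67.5·T₀) < 10⁻¹⁴`.
Nothing here bears on the truth of RH; RH is not proved; 24730 OPEN.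
-/

set_option linter.dupNamespace false

namespace Summit.RiemannHypothesis.RiemannHypothesis.Theorems.EarlyAppointmentsRemainder0Xi.KernelHighSide

open Set MeasureTheory intervalIntegral Real Filter Topology
open Literature.NumberTheory.LFunctions
open Literature.NumberTheory.LFunctions.SchoenfeldBound (zerosBetween countMain)
open Summit.RiemannHypothesis.RiemannHypothesis.Theorems.EarlyAppointmentsRemainder0Xi.HeightSumAbelBound (abs_Q_le_hsw)
open Summit.RiemannHypothesis.RiemannHypothesis.Theorems.EarlyAppointmentsRemainder0Xi.AbelHighSide (abs_Q_le_tangent)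

/-- the upper shift kernel `ψ_up(t) = 2/(t − x)²` … -/
noncomputable def psiUp (x t : ℝ) : ℝ := 2 / (t - x) ^ 2

/-- … and its derivative `−4/(t − x)³`. -/
noncomputable def psiUp' (x t : ℝ) : ℝ := -(4 / (t - x) ^ 3)

/-- the limit of BPT Theorem 2 for `ψ_up`: `Fsq(x,T₀) = −ψ_up(T₀)·Q(T₀) − ∫_{T₀}^∞ Q·ψ_up'`. -/
noncomputable def Fsq (x T₀ : ℝ) : ℝ :=
  -(psiUp x T₀ * ((zetaZeroCount T₀ : ℝ) - countMain T₀))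
    - ∫ t in Ioi T₀, ((zetaZeroCount t : ℝ) - countMain t) * psiUp' x t

/-- The high-side shift kernel `psiUp x` has derivative `psiUp' x t` at every `t ≠ x`. -/
theorem hasDerivAt_psiUp {x t : ℝ} (ht : t ≠ x) : HasDerivAt (psiUp x) (psiUp' x t) t := by
  have hxt : t - x ≠ 0 := sub_ne_zero.2 ht
  have h1 : HasDerivAt (fun s : ℝ ↦ (s - x) ^ 2) (2 * (t - x)) t := by
    have h := ((hasDerivAt_id t).sub_const x).mul ((hasDerivAt_id t).sub_const x)
    have e1 : (fun s : ℝ ↦ (s - x) ^ 2) = fun s ↦ (id s - x) * (id s - x) := by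
      funext s; simp only [id, sq]
    have e2 : 2 * (t - x) = 1 * (id t - x) + (id t - x) * 1 := by simp only [id]; ring
    rw [e1, e2]
    exact h
  have hne : (t - x) ^ 2 ≠ 0 := pow_ne_zero 2 hxt
  have h := (hasDerivAt_const t (2 : ℝ)).div h1 hne
  have e : (0 * (t - x) ^ 2 - 2 * (2 * (t - x))) / ((t - x) ^ 2) ^ 2 = -(4 / (t - x) ^ 3) := by
    rw [← neg_div, div_eq_div_iff (pow_ne_zero 2 hne) (pow_ne_zero 3 hxt)]
    ring
  rw [e] at h
  exact h

/-- `ψ_up` is `C¹`, nonnegative and nonincreasing on `Ici T₀` when `x < T₀`. -/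
theorem psiUp_hyps {x T₀ : ℝ} (hxT : x < T₀) :
    (∀ t ∈ Ici T₀, HasDerivAt (psiUp x) (psiUp' x t) t) ∧ ContinuousOn (psiUp' x) (Ici T₀) ∧
    (∀ t ∈ Ici T₀, 0 ≤ psiUp x t) ∧ (∀ t ∈ Ici T₀, psiUp' x t ≤ 0) := by
  have hgt : ∀ t ∈ Ici T₀, x < t := fun t ht ↦ lt_of_lt_of_le hxT (Set.mem_Ici.1 ht)
  refine ⟨fun t ht ↦ hasDerivAt_psiUp (hgt t ht).ne', ?_, fun t ht ↦ ?_, fun t ht ↦ ?_⟩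
  · unfold psiUp'
    refine ContinuousOn.neg (ContinuousOn.div (by fun_prop) (by fun_prop) fun t ht ↦ ?_)
    exact pow_ne_zero 3 (sub_ne_zero.2 (hgt t ht).ne')
  · unfold psiUp
    positivity
  · unfold psiUp'
    have h0 : 0 ≤ t - x := by linarith [hgt t ht]
    exact neg_nonpos.2 (div_nonneg (by norm_num) (pow_nonneg h0 3))

/-- an antiderivative of `ψ_up`: `d/dt (−2/(t − x)) = 2/(t − x)²`. -/
theorem hasDerivAt_negTwoDiv {x t : ℝ} (ht : t ≠ x) : HasDerivAt (fun s : ℝ ↦ -(2 / (s - x))) (psiUp x t) t := by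
  have hxt : t - x ≠ 0 := sub_ne_zero.2 ht
  have h1 : HasDerivAt (fun s : ℝ ↦ s - x) 1 t := (hasDerivAt_id t).sub_const x
  have h := ((hasDerivAt_const t (2 : ℝ)).div h1 hxt).neg
  have e : -((0 * (t - x) - 2 * 1) / (t - x) ^ 2) = psiUp x t := by
    unfold psiUp
    ring
  rw [e] at h
  exact h

/-- `−2/(s − x) → 0` as `s → ∞`. -/
theorem tendsto_negTwoDiv {x : ℝ} : Tendsto (fun s : ℝ ↦ -(2 / (s - x))) atTop (𝓝 0) := by
  have hg : Tendsto (fun s : ℝ ↦ s - x) atTop atTop :=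
    Filter.tendsto_atTop_atTop.2 fun b ↦ ⟨b + x, fun s hs ↦ by linarith⟩
  have h := (tendsto_const_nhds (x := (2 : ℝ))).div_atTop hg
  have h' := h.neg
  rw [neg_zero] at h'
  exact h'

/-- `psiUp x` is integrable on `(T₀, ∞)` when `x < T₀`. -/
theorem integrableOn_psiUp {x T₀ : ℝ} (hxT : x < T₀) : IntegrableOn (psiUp x) (Ioi T₀) :=
  integrableOn_Ioi_deriv_of_nonneg (hasDerivAt_negTwoDiv hxT.ne').continuousAt.continuousWithinAt
    (fun _ ht ↦ hasDerivAt_negTwoDiv (hxT.trans (Set.mem_Ioi.1 ht)).ne')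
    (fun t _ ↦ by unfold psiUp; positivity) tendsto_negTwoDiv

/-- `∫_{T₀}^∞ ψ_up = 2/(T₀ − x)`. -/
theorem integral_psiUp_eq {x T₀ : ℝ} (hxT : x < T₀) : ∫ t in Ioi T₀, psiUp x t = 2 / (T₀ - x) := by
  rw [integral_Ioi_of_hasDerivAt_of_nonneg (hasDerivAt_negTwoDiv hxT.ne').continuousAt.continuousWithinAt
    (fun _ ht ↦ hasDerivAt_negTwoDiv (hxT.trans (Set.mem_Ioi.1 ht)).ne')
    (fun t _ ↦ by unfold psiUp; positivity) tendsto_negTwoDiv]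
  ring

/-- `t ↦ psiUp x t / t` is continuous on `(T₀, ∞)` when `x < T₀` and `0 < T₀`. -/
theorem continuousOn_psiUp_div {x T₀ : ℝ} (hxT : x < T₀) (hT : 0 < T₀) :
    ContinuousOn (fun t ↦ psiUp x t / t) (Ioi T₀) := by
  unfold psiUp
  refine ContinuousOn.div (ContinuousOn.div (by fun_prop) (by fun_prop) fun t ht ↦ ?_) (by fun_prop) fun t ht ↦ ?_
  · exact pow_ne_zero 2 (sub_ne_zero.2 (hxT.trans (Set.mem_Ioi.1 ht)).ne')
  · exact (hT.trans (Set.mem_Ioi.1 ht)).ne'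

/-- `ψ_up/t` is integrable on `Ioi T₀` (dominated by `ψ_up/T₀`). -/
theorem integrableOn_psiUp_div {x T₀ : ℝ} (hxT : x < T₀) (hT : 0 < T₀) :
    IntegrableOn (fun t ↦ psiUp x t / t) (Ioi T₀) := by
  have hdom : IntegrableOn (fun t ↦ psiUp x t / T₀) (Ioi T₀) := (integrableOn_psiUp hxT).div_const T₀
  refine hdom.mono' ((continuousOn_psiUp_div hxT hT).aestronglyMeasurable measurableSet_Ioi) ?_
  refine (ae_restrict_iff' measurableSet_Ioi).2 (ae_of_all _ fun t ht ↦ ?_)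
  have ht' : T₀ < t := Set.mem_Ioi.1 ht
  have hψ : 0 ≤ psiUp x t := by unfold psiUp; positivity
  rw [Real.norm_eq_abs, abs_of_nonneg (div_nonneg hψ (hT.trans ht').le)]
  exact div_le_div_of_nonneg_left hψ hT ht'.le

/-- `∫_{T₀}^∞ ψ_up/t ≤ 2/((T₀ − x)·T₀)`. -/
theorem integral_psiUp_div_le {x T₀ : ℝ} (hxT : x < T₀) (hT : 0 < T₀) :
    ∫ t in Ioi T₀, psiUp x t / t ≤ 2 / ((T₀ - x) * T₀) := by
  have hdom : IntegrableOn (fun t ↦ psiUp x t / T₀) (Ioi T₀) := (integrableOn_psiUp hxT).div_const T₀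
  have hle : ∫ t in Ioi T₀, psiUp x t / t ≤ ∫ t in Ioi T₀, psiUp x t / T₀ := by
    refine setIntegral_mono_on (integrableOn_psiUp_div hxT hT) hdom measurableSet_Ioi fun t ht ↦ ?_
    have ht' : T₀ < t := Set.mem_Ioi.1 ht
    have hψ : 0 ≤ psiUp x t := by unfold psiUp; positivity
    exact div_le_div_of_nonneg_left hψ hT ht'.le
  have heq : ∫ t in Ioi T₀, psiUp x t / T₀ = 2 / ((T₀ - x) * T₀) := by
    rw [MeasureTheory.integral_div, integral_psiUp_eq hxT, div_div]
  linarith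

/-- ★ (K) **UPPER SIDE of LEAF 1's height sum — the T-uniform limit** (Brent–Platt–Trudgian Theorem 2 for `ψ_up`): for `x < T₀`,
`3 ≤ T₀`, `Σ_{T₀<γ≤T} ord·ψ_up(γ) − (∫_{T₀}^T ψ_up·log(t/2π))/(2π) → Fsq(x,T₀)` as `T → ∞`. -/
theorem highSide_tendsto_sq {x T₀ : ℝ} (hxT : x < T₀) (h3 : 3 ≤ T₀) :
    Tendsto (fun T ↦ ∑ ρ ∈ zerosBetween T₀ T, (riemannZetaZeroOrder ρ : ℝ) * psiUp x ρ.im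
        - (∫ t in T₀..T, psiUp x t * Real.log (t / (2 * π))) / (2 * π)) atTop (𝓝 (Fsq x T₀)) := by
  obtain ⟨hφ, hφ'c, hφ0, hφ'0⟩ := psiUp_hyps hxT
  exact BrentPlattTrudgian2021_thm2 h3 hφ hφ'c hφ0 hφ'0 (integrableOn_psiUp_div hxT (by linarith))

/-- ★ (K) **the limit is small**: `|Fsq(x,T₀)| ≤ 2·W_N(T₀)·ψ_up(T₀) + (0.1038 + 0.2573/log T₀)·∫_{T₀}^∞ ψ_up/t` for `e ≤ T₀`,
`3 ≤ T₀`, `x < T₀`. -/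
theorem abs_Fsq_le {x T₀ : ℝ} (hxT : x < T₀) (h3 : 3 ≤ T₀) (he : Real.exp 1 ≤ T₀) :
    |Fsq x T₀| ≤ 2 * (0.1038 * Real.log T₀ + 0.2573 * Real.log (Real.log T₀) + 10.2425) * psiUp x T₀
        + (0.1038 + 0.2573 / Real.log T₀) * ∫ t in Ioi T₀, psiUp x t / t := by
  obtain ⟨hφ, hφ'c, hφ0, hφ'0⟩ := psiUp_hyps hxT
  have hT0 : 0 < T₀ := by linarith
  have hint := integrableOn_psiUp_div hxT hT0
  have hl1 : 1 ≤ Real.log T₀ := by rw [Real.le_log_iff_exp_le hT0]; exact he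
  have hlpos : 0 < Real.log T₀ := by linarith
  have hll0 : 0 ≤ Real.log (Real.log T₀) := Real.log_nonneg hl1
  have hA : (0 : ℝ) ≤ 0.1038 + 0.2573 / Real.log T₀ := by positivity
  have hB : (0 : ℝ) ≤ 10.2425 + 0.2573 * (Real.log (Real.log T₀) - 1) := by nlinarith
  have hI := BPT2021.abs_integral_Ioi_count_sub_countMain_mul_deriv_le h3 hA hB
    (fun t ht ↦ abs_Q_le_tangent he ht) hφ hφ'c hφ0 hφ'0 hint
  have hQ0 := abs_Q_le_hsw (t := T₀) he
  have hφT : 0 ≤ psiUp x T₀ := hφ0 T₀ Set.self_mem_Ici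
  have h1 : |psiUp x T₀ * ((zetaZeroCount T₀ : ℝ) - countMain T₀)| ≤
      (0.1038 * Real.log T₀ + 0.2573 * Real.log (Real.log T₀) + 10.2425) * psiUp x T₀ := by
    rw [abs_mul, abs_of_nonneg hφT, mul_comm]
    exact mul_le_mul_of_nonneg_right hQ0 hφT
  have htouch : (0.1038 + 0.2573 / Real.log T₀) * Real.log T₀ + (10.2425 + 0.2573 * (Real.log (Real.log T₀) - 1)) =
      0.1038 * Real.log T₀ + 0.2573 * Real.log (Real.log T₀) + 10.2425 := by
    field_simp
    ring
  rw [htouch] at hI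
  have htri := abs_sub (-(psiUp x T₀ * ((zetaZeroCount T₀ : ℝ) - countMain T₀)))
    (∫ t in Ioi T₀, ((zetaZeroCount t : ℝ) - countMain t) * psiUp' x t)
  rw [abs_neg] at htri
  unfold Fsq
  linarith

/-- (K) the edge value: `2·ψ_up(x + 67.5) = 4/67.5²` (stated for a general gap `h`). -/
theorem two_psiUp_edge (x h : ℝ) : 2 * psiUp x (x + h) = 4 / h ^ 2 := by
  unfold psiUp
  ring

/-- the truncated kernel integral: `∫_{T₀}^T ψ_up = 2/(T₀ − x) − 2/(T − x) ≤ 2/(T₀ − x)` for `x < T₀ ≤ T`. -/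
theorem integral_psiUp_trunc_eq {x T₀ T : ℝ} (hxT : x < T₀) (hT : T₀ ≤ T) :
    ∫ t in T₀..T, psiUp x t = 2 / (T₀ - x) - 2 / (T - x) := by
  have hlt : ∀ t ∈ uIcc T₀ T, x < t := by
    intro t ht
    rw [uIcc_of_le hT] at ht
    linarith [ht.1]
  have hderiv : ∀ t ∈ uIcc T₀ T, HasDerivAt (fun s : ℝ ↦ -(2 / (s - x))) (psiUp x t) t :=
    fun t ht ↦ hasDerivAt_negTwoDiv (hlt t ht).ne'
  have hcont : ContinuousOn (psiUp x) (uIcc T₀ T) := by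
    unfold psiUp
    refine ContinuousOn.div (by fun_prop) (by fun_prop) fun t ht ↦ ?_
    exact pow_ne_zero 2 (sub_ne_zero.2 (hlt t ht).ne')
  rw [integral_eq_sub_of_hasDerivAt hderiv hcont.intervalIntegrable]
  ring

/-- Truncated high-side integral: `∫_{T₀}^{T} psiUp x ≤ 2/(T₀ − x)` for `x < T₀ ≤ T`. -/
theorem integral_psiUp_trunc_le {x T₀ T : ℝ} (hxT : x < T₀) (hT : T₀ ≤ T) :
    ∫ t in T₀..T, psiUp x t ≤ 2 / (T₀ - x) := by
  rw [integral_psiUp_trunc_eq hxT hT]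
  have h : 0 ≤ 2 / (T - x) := div_nonneg (by norm_num) (by linarith)
  linarith

/-- ★ (K) **the truncated main term of LEAF 1's upper side**: for `x < T₀ ≤ T` with `2π ≤ T₀`,
`(∫_{T₀}^T ψ_up·log(t/2π))/(2π) ≤ log(T/2π)·(2/(T₀ − x))/(2π)` (carries `log T`; see the module docstring for the T-free use). -/
theorem integral_psiUp_log_le {x T₀ T : ℝ} (hxT : x < T₀) (hT : T₀ ≤ T) (h2π : 2 * π ≤ T₀) :
    (∫ t in T₀..T, psiUp x t * Real.log (t / (2 * π))) / (2 * π)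
      ≤ Real.log (T / (2 * π)) * (2 / (T₀ - x)) / (2 * π) := by
  have h2pi : 0 < 2 * π := by positivity
  have hlt : ∀ t ∈ Icc T₀ T, x < t := fun t ht ↦ by linarith [ht.1]
  have hcont : ContinuousOn (psiUp x) (Icc T₀ T) := by
    unfold psiUp
    refine ContinuousOn.div (by fun_prop) (by fun_prop) fun t ht ↦ ?_
    exact pow_ne_zero 2 (sub_ne_zero.2 (hlt t ht).ne')
  have hlogc : ContinuousOn (fun t : ℝ ↦ Real.log (t / (2 * π))) (Icc T₀ T) := by
    refine ContinuousOn.log (by fun_prop) fun t ht ↦ ?_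
    have : 0 < t := by linarith [ht.1]
    positivity
  have hmono : ∀ t ∈ Icc T₀ T, psiUp x t * Real.log (t / (2 * π)) ≤ psiUp x t * Real.log (T / (2 * π)) := by
    intro t ht
    have ht0 : 0 < t := by linarith [ht.1]
    have hψ : 0 ≤ psiUp x t := by unfold psiUp; positivity
    refine mul_le_mul_of_nonneg_left (Real.log_le_log (by positivity) ?_) hψ
    exact div_le_div_of_nonneg_right ht.2 h2pi.le
  have hI : ∫ t in T₀..T, psiUp x t * Real.log (t / (2 * π)) ≤ ∫ t in T₀..T, psiUp x t * Real.log (T / (2 * π)) := by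
    refine intervalIntegral.integral_mono_on hT ?_ ?_ hmono
    · exact (hcont.mul hlogc).intervalIntegrable_of_Icc hT
    · exact (hcont.mul continuousOn_const).intervalIntegrable_of_Icc hT
  rw [intervalIntegral.integral_mul_const] at hI
  have hlog0 : 0 ≤ Real.log (T / (2 * π)) := by
    apply Real.log_nonneg
    rw [le_div_iff₀ h2pi]
    linarith
  have hJ := mul_le_mul_of_nonneg_right (integral_psiUp_trunc_le hxT hT) hlog0
  have hK : ∫ t in T₀..T, psiUp x t * Real.log (t / (2 * π)) ≤ Real.log (T / (2 * π)) * (2 / (T₀ - x)) :=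
    hI.trans (hJ.trans_eq (by ring))
  exact div_le_div_of_nonneg_right hK h2pi.le

end Summit.RiemannHypothesis.RiemannHypothesis.Theorems.EarlyAppointmentsRemainder0Xi.KernelHighSide
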